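import Summits.HodgeConjecture.HodgeConjecture.Theorems.Ring2AbelianAllLefschetzPencilsGraded
import Summits.HodgeConjecture.HodgeConjecture.Theorems.Ring2AbelianAllAndreFibreClass
import Literature.AlgebraicGeometry.HodgeTheory.StandardConjectureAOfHodgeClasses
import Literature.AlgebraicGeometry.HodgeTheory.HardLefschetzNFoldHolds
import HarnessLib

/-!
# Ring 2 · §AbelianAll (seat `ab-andre-1`), XIV — the transport hypothesis IN PRINT'S OWN FORM: Grothendieck's
# `A(𝒳, L)` (`⇔ D(𝒳)` in characteristic `0`) on the pencil TOTAL SPACE, a node a priori WEAKER than the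
# `⋆_L`-form `B(𝒳)` of parts I/VII; `B ⇒ A` on the real carriers (kernel, unconditional); rung `d ≤ 2` and the
# on-path certificate FACT-FREE (the transport rows on the `A`-node follow in part XIV-b)

HONEST FRAMING: research route, not a corollary; conditional on HC_CM plus one named minimal statement.
(Cell line: research route conditional on HC_CM; not a corollary; Q11.4-sentence-2 already refuted in dim ≥ 3.)

Cell `pub-hodge-ring2`, sub-cell `pub-hodge-ring2-ab-*` (ALL ABELIAN VARIETIES), seat `ab-andre-1`, gen 26
(rev 2, gen 28: DOCSTRING-ONLY revision per REFEREE-AB R-28 F-ab-78 — the three "open for `d ≥ 3`" clauses below now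
agree with part XIV-c `Ring2AbelianAllStandardAPencilsLowRungs` (p216742): in the `A`-form the rungs `d ≤ 3` are
PROVED fact-free and the first open rung is `d = 4`; no declaration, statement or proof changed).
`HC_CM` = `Theses.RankFourFaces.CMAbelianHodge` (stmt-HodgeConjecture-3052), a BINDER; `HC_AV` =
`Theses.PadicSemiregularLift.HodgeAbelianVarieties` (stmt-1333); the item `Theses.RankFourFaces.CMToAbelian`
(stmt-16267) is OPEN and NOT closed here. Nothing below proves a case of the Hodge conjecture; every OPEN statement
is an `@[conjecture] def` used only as a hypothesis; THIS part uses NO named fact at all (the transport rows on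
the new node — Abdulali 1994 p. 1122 / Milne 2020 Prop. 1 with the hypothesis AS PRINTED, the companion Literature
fact `Abdulali1994_invariantCycles_of_lefschetzStandardA` — are part XIV-b, filed once that fact has landed). No
statement minted in this cell is cited as a fact.

## Why this part exists

Parts I/VII typed André's Remarque 2 candidate ("si l'involution de Lefschetz … sur les pinceaux compacts de
variétés abéliennes est donnée par une correspondance algébrique", §6.3 p. 33) as `B(𝒳)` in the `⋆_L`-FORM
(`StandardConjectureBStar`) for the `(d+1)`-dimensional total spaces: nodes (5∀) `CompactAbelianPencilLefschetz` /
(5) `CMPointedPencilLefschetz` (graded: `LefschetzBCompactPencilsAtRelDim`, `LefschetzBCMPointedPencilsAtRelDim`).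
But the transport theorem those nodes feed — Abdulali 1994 p. 1122 in Milne's restatement (2020, Prop. 1, p. 7)
— assumes LESS in print: "the standard conjecture of Lefschetz type asserts that this map
[`L^{d-2i} : aH^{2i}(X, ℚ) → aH^{2d-2i}(X, ℚ)`] is surjective", i.e. Grothendieck's `A(A, L)` (Bombay 1968 §3
p. 196), equivalently `D(A)` (numerical = homological equivalence) in characteristic `0`; and Y. André's 2026
account of the same step (arXiv:2601.21052, PREPRINT, §4.4.1) names it as "the standard conjecture D for the total
space `f : A → S` of a pencil of abelian varieties 'of the same Hodge type' parametrized by a smooth projective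
curve". Per variety `B(X) ⇒ A(X, L) ⇔ D(X)` while `B(X)` is only known to follow from `A(X × X)` (Grothendieck
loc. cit.; Milne 2020 Rem. 5), so ON ONE PENCIL TOTAL SPACE the `A`/`D`-form is an a priori smaller ask than the
`⋆_L`-form. The tree already carries `A(X, η)` on the real carriers (`HodgeTheory.StandardConjectureA`, with the
theorems `standardConjectureA_of_hodgeConjectureFor` and `standardConjectureA_of_dim_le_three`), so the smaller
node is typable today, and two of its certificates come for free.

## What is PROVED here (kernel-checked, sorry-free)

* §0 `standardConjectureA_of_standardConjectureBStar` — **Grothendieck's "`B(X) ⇒ A(X)`" ON THE REAL CARRIERS,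
  unconditionally**: for `X` smooth projective of dimension `n` and a polarisation class `η`, `⋆_L` algebraic in
  every degree gives `A(X, η)` (`⋆_L : N^q H^{2n-2p} → H^{2p}` lands in `Nᵖ` because algebraic correspondences
  preserve algebraic classes — seat ab-andre-2's `map_mem_algebraicClasses_of_isAlgebraicCorrespondence`, fed by the
  tree's THEOREM `Voisin2003_cupProduct_algebraicClasses_holds` — and `Lʳ ∘ ⋆_L = id` above the middle).
* §A the nodes `CompactAbelianPencilStandardA` (A_pen∀), `CMPointedPencilStandardA` (A_pen^CM) and their graded
  forms `StandardACompactPencilsAtRelDim d`, `StandardACMPointedPencilsAtRelDim d`; non-vacuity of their inner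
  hypothesis (`exists_isPolarizationClass_total`).
* §B ORDER: (5∀) ⟹ A_pen∀ ⟹ A_pen^CM ⟸ (5), gradedly too (kernel, by §0); ON-PATH: `HodgeConjecture ⟹ A_pen∀`
  by a tree THEOREM (`standardConjectureA_of_hodgeConjectureFor`) — no `hK` (contrast part I
  `compactAbelianPencilLefschetz_of_hodgeConjecture`, which needs Kleiman/Voisin `hK`).
* §C RUNGS: `StandardACompactPencilsAtRelDim d` for every `d ≤ 2` FACT-FREE (total space of dimension `≤ 3`:
  `standardConjectureA_of_dim_le_three`) — contrast the `B`-ladder, where `d = 2` is Tankeev 2011 (part X, a named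
  fact) and `d = 1` is the surface case. SHARPENED in part XIV-c (`Ring2AbelianAllStandardAPencilsLowRungs`): `d ≤ 3`
  FACT-FREE in both families (`standardACompactPencilsAtRelDim_of_le_three`, `standardACMPointedPencilsAtRelDim_of_le_three`),
  because `A(X, η)` holds for EVERY smooth complex projective `X` of dimension `≤ 4` (`standardConjectureA_of_dim_le_four`:
  the middle-codimension clause of `A` is the identity and codimension `1` is Lefschetz `(1,1)`); the first open `A`-rung is
  `d = 4` (fivefold total spaces), one surjectivity `L_η : N²H⁴(𝒳) ↠ N³H⁶(𝒳)` per pencil and polarisation class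
  (`standardACompactPencilsAtRelDim_four_iff_surjOn`).
* (part XIV-b, separate file `Ring2AbelianAllStandardAPencilsTransport`, granted the companion fact `h₈A`) the rows
  on the `A`-node: `h₈A ⟹ h₈`; `h₈A → A_pen^CM → CMFibreTransport`; `h₈A → h₂₁ → HC_CM → A_pen^CM → HC_AV`;
  `h₈A → J^{CM} → A_pen^CM → HC_CM` — the columns parts I–III record for (5), one node lower.

## What is NOT claimed

`A_pen^CM` is not claimed minimal, nor strictly weaker than (5) (no separation of `A(X)` from `B(X)` is known for
any `X`); `D(𝒳)` itself (numerical = homological) is not typed here — only its characteristic-`0` equivalent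
`A(𝒳, η)`; the rung `d = 3` (abelian-threefold pencils, fourfold total spaces) is open in the `⋆_L`-form and PROVED in the
`A`-form (part XIV-c, fact-free); in the `A`-form the nodes are open for `d ≥ 4` only. André 2026 is cited as a preprint (arXiv:2601.21052 v2; venue unverified).

## References

* [Andre1996Motifs] Y. André, Publ. Math. IHÉS 83 (1996), §6.3 Lemme 6.3.1, Remarque 2 (pp. 31–33).
* [Abdulali1994FamiliesAV] S. Abdulali, Canad. J. Math. 46 (1994), p. 1122.
* [Milne2020HodgeClassesAV] J. S. Milne, Hodge classes on abelian varieties (2020), p. 7 (Prop. 1), Rem. 5.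
* [Grothendieck1968] A. Grothendieck, Standard conjectures on algebraic cycles (Bombay 1968), §3 p. 196.
* [Kleiman1968AlgebraicCycles] S. Kleiman, Algebraic cycles and the Weil conjectures (1968), §2–§3.
* [VoisinHodgeII2003] C. Voisin, Hodge Theory and Complex Algebraic Geometry II, Prop. 9.20–9.21, (10.7).
* Y. André, Non-abelian Rees construction and pure motives, arXiv:2601.21052 (2026, preprint), §4.4.1, §4.4.3.
-/

noncomputable section

set_option linter.dupNamespace false

namespace Summit.HodgeConjecture.HodgeConjecture.Ring2.AbelianAll

open CategoryTheory AlgebraicGeometry MonoidalCategory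
open Literature.AlgebraicGeometry Literature.AlgebraicGeometry.Motives
open Literature.AlgebraicGeometry.HodgeTheory
open Literature.AlgebraicGeometry.Milne1999 (IsOfCMType)
open Literature.AlgebraicGeometry.Deligne1982 (cmLocus)
open Summit.HodgeConjecture.HodgeConjecture
open Summit.HodgeConjecture.HodgeConjecture.Theses

/-! ## §0 Grothendieck's `B(X) ⇒ A(X)` on the real carriers (unconditional) -/

/-- **`B(X)` in André's `⋆_L`-form implies Grothendieck's `A(X, η)`, on the real carriers** (Grothendieck, Bombay
1968, §3 p. 196: "`B(X) ⇒ A(X)`"; Kleiman 1968 §2). For `X` smooth projective of dimension `n` and a polarisation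
class `η`: (a) hard Lefschetz is part of `IsPolarizationClass`; (b) for `2p + r = n`, `p + r = q`, `Lʳ` maps
`Nᵖ H²ᵖ` into `N^q H^{2p+2r}` (`lefschetzPow_mapsTo_algebraicClasses`, unconditional), is injective (hard
Lefschetz), and is ONTO: for `y ∈ N^q H^{2p+2r}`, `x := ⋆_L y ∈ H²ᵖ` is algebraic because `⋆_L : H^{2q} → H^{2p}` is
an algebraic correspondence (`B(X)`) and algebraic correspondences preserve algebraic classes
(`map_mem_algebraicClasses_of_isAlgebraicCorrespondence`, Voisin II Prop. 9.21 with the tree's theorem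
`Voisin2003_cupProduct_algebraicClasses_holds`), and `Lʳ x = y` (`lefschetzPow_lefschetzInvolution`). No hypothesis
beyond `B(X)`. [cite: Grothendieck1968, §3 p. 196 (B(X) ⇒ A(X))] [cite: Kleiman1968AlgebraicCycles, §2]
[cite: VoisinHodgeII2003, §9.2.4 Prop. 9.20–9.21 and (10.7)] -/
theorem standardConjectureA_of_standardConjectureBStar {n : ℕ} {X : SchemeOver ℂ} {η : complexBetti X 2}
    (hX : IsSmoothProjective n X) (hη : IsPolarizationClass n X η) (hB : StandardConjectureBStar n X η) :
    StandardConjectureA n X η := by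
  refine ⟨hη.hasHardLefschetz, fun p r q hpr hq ↦ ⟨?_, ?_, ?_⟩⟩
  · exact lefschetzPow_mapsTo_algebraicClasses hX hη.mem_algebraicClasses hq
  · exact (hη.hasHardLefschetz r (2 * p) hpr).1.injOn
  · -- onto: `x := ⋆_L y` is algebraic and `Lʳ x = y`
    have key : ∀ {i : ℕ} (z : complexBetti X i), z ∈ supportedClasses X i q → ∀ (hi : i = 2 * q)
        (hab : i + 2 * p = 2 * n), lefschetzInvolution hη.hasHardLefschetz hab z ∈ algebraicClasses X p := by
      intro i z hz hi hab
      subst hi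
      exact map_mem_algebraicClasses_of_isAlgebraicCorrespondence hX hX (hB hη (2 * q) (2 * p) hab) hz
    intro y hy
    have hab : 2 * p + 2 * r + 2 * p = 2 * n := by omega
    exact ⟨lefschetzInvolution hη.hasHardLefschetz hab y, key y hy (by omega) hab,
      lefschetzPow_lefschetzInvolution hη.hasHardLefschetz hpr hab y⟩

/-- `B(X)` in `⋆_L`-form for every `η` gives `A(X, η)` for every polarisation class `η` (the quantifier shapes of the
cell's pencil nodes). [cite: Grothendieck1968, §3 p. 196 (B(X) ⇒ A(X))] -/
theorem forall_standardConjectureA_of_forall_standardConjectureBStar {n : ℕ} {X : SchemeOver ℂ}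
    (hX : IsSmoothProjective n X) (hB : ∀ η : complexBetti X 2, StandardConjectureBStar n X η) :
    ∀ η : complexBetti X 2, IsPolarizationClass n X η → StandardConjectureA n X η :=
  fun η hη ↦ standardConjectureA_of_standardConjectureBStar hX hη (hB η)

/-! ## §A The nodes: `A(𝒳, η)` on the total space of compact abelian pencils -/

/-- **`A` ON COMPACT ABELIAN PENCILS** (A_pen∀): for every compact pencil of abelian varieties `f : 𝒳 ⟶ S` of
relative dimension `d` and every polarisation class `η` of the `(d+1)`-dimensional total space, Grothendieck's
`A(𝒳, η)` (`StandardConjectureA (d + 1) 𝒳 η`: hard Lefschetz and `Lʳ : Nᵖ H²ᵖ ⥲ N^{p+r} H^{2p+2r}`, `2p + r = d + 1`).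
This is the hypothesis of Abdulali p. 1122 / Milne 2020 Prop. 1 AS PRINTED ("the standard conjecture of Lefschetz
type asserts that this map is surjective"), equivalently (characteristic `0`) conjecture `D(𝒳)`, the form of
André 2026 §4.4.1 (arXiv:2601.21052, preprint). OPEN for `d ≥ 4` (the rungs `d ≤ 3` are PROVED fact-free: §C for
`d ≤ 2`, part XIV-c `standardACompactPencilsAtRelDim_of_le_three` for `d ≤ 3`); implied by the `⋆_L`-form node (5∀)
`CompactAbelianPencilLefschetz` (§B) and by the Hodge conjecture (tree theorem, §B).
A HYPOTHESIS wherever used. [cite: Milne2020HodgeClassesAV, p. 7 (definition preceding Prop. 1) and Prop. 1]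
[cite: Grothendieck1968, §3 p. 196 (A(X))] [cite: Andre1996Motifs, §6.3 Remarque 2 (p. 33)] -/
@[conjecture] def CompactAbelianPencilStandardA : Prop :=
  ∀ ⦃d : ℕ⦄ ⦃𝒳 S : SchemeOver ℂ⦄ (f : 𝒳 ⟶ S), IsCompactAbelianPencil f d →
    ∀ η : complexBetti 𝒳 2, IsPolarizationClass (d + 1) 𝒳 η → StandardConjectureA (d + 1) 𝒳 η

/-- **`A` ON CM-POINTED COMPACT ABELIAN PENCILS** (A_pen^CM): `A(𝒳, η)` for every polarisation class of the total
space, asked only of the compact abelian pencils possessing a fibre `𝒳_t ≅ A₀.X` with `A₀` of CM type (the pencils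
of Lemme 6.3.1 (ii) are such). OPEN for `d ≥ 4` (the rungs `d ≤ 3` are PROVED fact-free, part XIV-c
`standardACMPointedPencilsAtRelDim_of_le_three`); implied by A_pen∀ and by the `⋆_L`-node (5)
`CMPointedPencilLefschetz` (§B). With `HC_CM` it gives `HC_AV` granted Abdulali p. 1122 in print's form and Lemme 6.3.1
(part XIV-b). Not claimed minimal, nor
strictly weaker than (5). A HYPOTHESIS wherever used. [cite: Andre1996Motifs, Lemme 6.3.1 (ii) (p. 31) and Remarque 2 (p. 33)]
[cite: Milne2020HodgeClassesAV, Prop. 1 (p. 7)] [cite: Grothendieck1968, §3 p. 196 (A(X))] -/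
@[conjecture] def CMPointedPencilStandardA : Prop :=
  ∀ ⦃d : ℕ⦄ ⦃𝒳 S : SchemeOver ℂ⦄ (f : 𝒳 ⟶ S), IsCompactAbelianPencil f d →
    (∃ (t : ComplexPoints S) (A₀ : AbelianVariety ℂ), Nonempty (A₀.X ≅ fiberOver f t) ∧ IsOfCMType A₀) →
      ∀ η : complexBetti 𝒳 2, IsPolarizationClass (d + 1) 𝒳 η → StandardConjectureA (d + 1) 𝒳 η

/-- **A_pen∀ GRADED BY THE RELATIVE DIMENSION**: `A(𝒳, η)` for the compact pencils of abelian `d`-folds (total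
spaces of dimension `d + 1`). [cite: Grothendieck1968, §3 p. 196 (A(X))] [cite: Andre1996Motifs, §6.3 Remarque 2 (p. 33)] -/
@[conjecture] def StandardACompactPencilsAtRelDim (d : ℕ) : Prop :=
  ∀ ⦃𝒳 S : SchemeOver ℂ⦄ (f : 𝒳 ⟶ S), IsCompactAbelianPencil f d →
    ∀ η : complexBetti 𝒳 2, IsPolarizationClass (d + 1) 𝒳 η → StandardConjectureA (d + 1) 𝒳 η

/-- **A_pen^CM GRADED**: the same for the compact pencils of abelian `d`-folds having a CM fibre (`cmLocus f d`
non-empty, seat ab-andre-2's spelling of the CM-pointed clause, as in part VII).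
[cite: Andre1996Motifs, Lemme 6.3.1 (ii) (p. 31)] [cite: Grothendieck1968, §3 p. 196 (A(X))] -/
@[conjecture] def StandardACMPointedPencilsAtRelDim (d : ℕ) : Prop :=
  ∀ ⦃𝒳 S : SchemeOver ℂ⦄ (f : 𝒳 ⟶ S), IsCompactAbelianPencil f d → (cmLocus f d).Nonempty →
    ∀ η : complexBetti 𝒳 2, IsPolarizationClass (d + 1) 𝒳 η → StandardConjectureA (d + 1) 𝒳 η

/-- **Non-vacuity of the inner hypothesis**: the total space of a compact abelian pencil carries a polarisation
class (a non-zero rational multiple of a hyperplane class: `nonempty_hardLefschetzNFold_holds`,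
`HardLefschetzNFold.isPolarizationClass`), so the nodes ask `A(𝒳, η)` of at least one `η` per pencil.
[cite: VoisinHodgeI2002, Thm. 6.25, Rem. 6.27 and §7.1.2] -/
theorem exists_isPolarizationClass_total {d : ℕ} {𝒳 S : SchemeOver ℂ} {f : 𝒳 ⟶ S}
    (hf : IsCompactAbelianPencil f d) : ∃ η : complexBetti 𝒳 2, IsPolarizationClass (d + 1) 𝒳 η := by
  obtain ⟨Λ⟩ := nonempty_hardLefschetzNFold_holds (d + 1) 𝒳 hf.isSmoothProjective_total
  exact ⟨Λ.hyperplaneClass, Λ.isPolarizationClass⟩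

/-! ## §B Order and on-path lemmas (kernel, unconditional) -/

/-- A_pen∀ is the conjunction of its graded pieces (definitionally). [folklore] -/
theorem compactAbelianPencilStandardA_iff_forall :
    CompactAbelianPencilStandardA ↔ ∀ d, StandardACompactPencilsAtRelDim d :=
  ⟨fun h _ _ _ f hf ↦ h f hf, fun h d _ _ f hf ↦ h d f hf⟩

/-- A_pen^CM is the conjunction of its graded pieces (the CM-pointed clause of part I and `(cmLocus f d).Nonempty`
say the same: the chart's dimension is forced, `Andre1996.compactPencil_dim_eq_of_iso`). [folklore] -/
theorem cmPointedPencilStandardA_iff_forall :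
    CMPointedPencilStandardA ↔ ∀ d, StandardACMPointedPencilsAtRelDim d :=
  ⟨fun h d _ _ f hf hCM ↦ by
      obtain ⟨t, A₀, he₀, -, hA₀⟩ := hCM
      exact h f hf ⟨t, A₀, he₀, hA₀⟩,
    fun h d _ _ f hf hCM ↦ by
      obtain ⟨t, A₀, ⟨e₀⟩, hA₀⟩ := hCM
      exact h d f hf ⟨t, A₀, ⟨e₀⟩, Andre1996.compactPencil_dim_eq_of_iso hf e₀, hA₀⟩⟩

/-- **(5∀) ⟹ A_pen∀** (`B ⇒ A` on the total space, §0). [cite: Grothendieck1968, §3 p. 196 (B(X) ⇒ A(X))] -/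
theorem compactAbelianPencilStandardA_of_compactAbelianPencilLefschetz (hB : CompactAbelianPencilLefschetz) :
    CompactAbelianPencilStandardA :=
  fun _ _ _ f hf ↦ forall_standardConjectureA_of_forall_standardConjectureBStar hf.isSmoothProjective_total (hB f hf)

/-- **(5) ⟹ A_pen^CM** (`B ⇒ A` on the total space, §0). [cite: Grothendieck1968, §3 p. 196 (B(X) ⇒ A(X))] -/
theorem cmPointedPencilStandardA_of_cmPointedPencilLefschetz (hB : CMPointedPencilLefschetz) :
    CMPointedPencilStandardA :=
  fun _ _ _ f hf hCM ↦
    forall_standardConjectureA_of_forall_standardConjectureBStar hf.isSmoothProjective_total (hB f hf hCM)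

/-- A_pen∀ ⟹ A_pen^CM (drop the CM-point hypothesis). [folklore] -/
theorem cmPointedPencilStandardA_of_compactAbelianPencilStandardA (hA : CompactAbelianPencilStandardA) :
    CMPointedPencilStandardA :=
  fun _ _ _ f hf _ ↦ hA f hf

/-- Graded: `(5∀)_d ⟹ (A∀)_d`. [cite: Grothendieck1968, §3 p. 196 (B(X) ⇒ A(X))] -/
theorem standardACompactPencilsAtRelDim_of_lefschetzB {d : ℕ} (hB : LefschetzBCompactPencilsAtRelDim d) :
    StandardACompactPencilsAtRelDim d :=
  fun _ _ f hf ↦ forall_standardConjectureA_of_forall_standardConjectureBStar hf.isSmoothProjective_total (hB f hf)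

/-- Graded: `(5)_d ⟹ (A^CM)_d`. [cite: Grothendieck1968, §3 p. 196 (B(X) ⇒ A(X))] -/
theorem standardACMPointedPencilsAtRelDim_of_lefschetzB {d : ℕ} (hB : LefschetzBCMPointedPencilsAtRelDim d) :
    StandardACMPointedPencilsAtRelDim d :=
  fun _ _ f hf hCM ↦
    forall_standardConjectureA_of_forall_standardConjectureBStar hf.isSmoothProjective_total (hB f hf hCM)

/-- Graded: `(A∀)_d ⟹ (A^CM)_d`. [folklore] -/
theorem standardACMPointedPencilsAtRelDim_of_compact {d : ℕ} (hA : StandardACompactPencilsAtRelDim d) :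
    StandardACMPointedPencilsAtRelDim d :=
  fun _ _ f hf _ ↦ hA f hf

/-- **ON-PATH (C6), FACT-FREE: `HodgeConjecture ⟹ A_pen∀`** — the Hodge conjecture for the total space `𝒳` itself
gives `A(𝒳, η)` for every polarisation class (tree theorem `standardConjectureA_of_hodgeConjectureFor`). Contrast
part I `compactAbelianPencilLefschetz_of_hodgeConjecture`, which needs the Kleiman/Voisin fact `hK` and the Hodge
conjecture for `𝒳 × 𝒳`. [cite: Grothendieck1968, §3 p. 196 (A(X))] [cite: VoisinHodgeI2002, Thm. 6.25 and §7.1.2] -/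
theorem compactAbelianPencilStandardA_of_hodgeConjecture (h : _root_.HodgeConjecture) :
    CompactAbelianPencilStandardA :=
  fun _ _ _ _ hf _ hη ↦
    standardConjectureA_of_hodgeConjectureFor hf.isSmoothProjective_total hη (h hf.isSmoothProjective_total)

/-- ON-PATH (C6), fact-free: `HodgeConjecture ⟹ A_pen^CM`. [folklore] -/
theorem cmPointedPencilStandardA_of_hodgeConjecture (h : _root_.HodgeConjecture) : CMPointedPencilStandardA :=
  cmPointedPencilStandardA_of_compactAbelianPencilStandardA (compactAbelianPencilStandardA_of_hodgeConjecture h)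

/-! ## §C Rungs: `d ≤ 2` fact-free -/

/-- **`(A∀)_d` HOLDS FOR EVERY `d ≤ 2`, unconditionally**: the total space is a smooth projective variety of
dimension `d + 1 ≤ 3`, for which `A(X, η)` is a THEOREM of the tree (`standardConjectureA_of_dim_le_three`, from the
Hodge conjecture in dimension `≤ 3`: Lefschetz `(1,1)` and hard Lefschetz). On the `B`-ladder the rung `d = 2` is
Tankeev 2011 (part X, named fact `Tankeev2011_lefschetzStandard_abelianSurfacePencil`).
[cite: Grothendieck1968, §3 p. 196 (A(X))] [cite: VoisinHodgeII2003, §10.2.3 proof of Prop. 10.26] -/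
theorem standardACompactPencilsAtRelDim_of_le_two {d : ℕ} (hd : d ≤ 2) : StandardACompactPencilsAtRelDim d :=
  fun _ _ _ hf _ hη ↦ standardConjectureA_of_dim_le_three (by omega) hf.isSmoothProjective_total hη

/-- `(A^CM)_d` holds for every `d ≤ 2`, unconditionally. [cite: Grothendieck1968, §3 p. 196 (A(X))] -/
theorem standardACMPointedPencilsAtRelDim_of_le_two {d : ℕ} (hd : d ≤ 2) : StandardACMPointedPencilsAtRelDim d :=
  standardACMPointedPencilsAtRelDim_of_compact (standardACompactPencilsAtRelDim_of_le_two hd)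

/-- Hence A_pen∀ is equivalent to its pieces of relative dimension `≥ 3`. [folklore] -/
theorem compactAbelianPencilStandardA_iff_forall_three_le :
    CompactAbelianPencilStandardA ↔ ∀ d, 3 ≤ d → StandardACompactPencilsAtRelDim d := by
  rw [compactAbelianPencilStandardA_iff_forall]
  refine ⟨fun h d _ ↦ h d, fun h d ↦ ?_⟩
  rcases Nat.lt_or_ge d 3 with hd | hd
  · exact standardACompactPencilsAtRelDim_of_le_two (by omega)
  · exact h d hd

/-- … and A_pen^CM to its pieces of relative dimension `≥ 3`. [folklore] -/
theorem cmPointedPencilStandardA_iff_forall_three_le :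
    CMPointedPencilStandardA ↔ ∀ d, 3 ≤ d → StandardACMPointedPencilsAtRelDim d := by
  rw [cmPointedPencilStandardA_iff_forall]
  refine ⟨fun h d _ ↦ h d, fun h d ↦ ?_⟩
  rcases Nat.lt_or_ge d 3 with hd | hd
  · exact standardACMPointedPencilsAtRelDim_of_le_two (by omega)
  · exact h d hd

/-- ON-PATH summary (C6): every NEW node of this file follows from the Hodge conjecture, with NO named fact.
[folklore] -/
theorem standardANodes_of_hodgeConjecture (h : _root_.HodgeConjecture) :
    CompactAbelianPencilStandardA ∧ CMPointedPencilStandardA ∧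
      (∀ d, StandardACompactPencilsAtRelDim d) ∧ (∀ d, StandardACMPointedPencilsAtRelDim d) :=
  ⟨compactAbelianPencilStandardA_of_hodgeConjecture h, cmPointedPencilStandardA_of_hodgeConjecture h,
    compactAbelianPencilStandardA_iff_forall.1 (compactAbelianPencilStandardA_of_hodgeConjecture h),
    cmPointedPencilStandardA_iff_forall.1 (cmPointedPencilStandardA_of_hodgeConjecture h)⟩

end Summit.HodgeConjecture.HodgeConjecture.Ring2.AbelianAll

end
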